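import Summits.Ventures.PackingBounds.Configurations.KissingNineteen
import Summits.Ventures.PackingBounds.Configurations.CL17Vectors

/-!
# Cohn–Li in dimension `17`, I: the binary codes of `𝔽₂^{4×4}` (kernel facts)

Framing: lottery ticket; floor = certified bounds/negative ranges. Venture `PackingBounds` (cell
`pub-packcert`, seat `pub-packcert-energy`).

H. Cohn and A. Li (*Improved kissing numbers in seventeen through twenty-one dimensions*, arXiv:2411.04916,
§3) identify `𝔽₂¹⁶` with the `4 × 4` binary matrices, let `C₁₀` be the matrices all of whose row and column sums
agree, and `C₆ = C₁₀^⊥`; `C₆` consists of `0`, `1`, `12` *pairs* and `18` *squares* (weight `8`), `16` *crosses*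
(weight `6`) and `16` anticrosses. The pairs and squares span `C₅ = RM(1,4) ⊂ C₁₀`, and `C₁₀` contains two
DISJOINT unions `C⁺, C⁻` of six cosets of `C₅`, each of minimum distance `6` (Lemma 3.3). This file enters these
objects as `16`-bit masks (cell `(i, j)` ↦ bit `4i + j`): `w8` (pairs and squares), `x6` (crosses), `c5` (the span
of five generators), `rep` (the `12` coset representatives; seat file `configs/code/cl17.py` found them) and
`cd p m = rep p ⊕ c5 m`, and lets the kernel check the finitely many facts the geometry needs (`decide +kernel`,
bit counts via `popK`; the parities only on coset representatives and generators, by additivity): supports of size `8` / `6`, pairwise intersections `≤ 4` (pairs/squares), `≤ 4`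
(pair/square with cross), `≤ 2` (crosses), every word of `C^±` meets every pair/square/cross evenly
(`C₁₀ ⊥ C₆`), and distances `≥ 6` inside `C⁺` and inside `C⁻`, `≥ 4` across. The vectors are in
`CL17Vectors.lean`, the count and the transfer to `ℝ¹⁷` in `CL17.lean`.

## References
* H. Cohn, A. Li, *Improved kissing numbers in seventeen through twenty-one dimensions*, arXiv:2411.04916 (2024), §3. [`CohnLi2024`]
-/

namespace Summit.Ventures.PackingBounds.Config.CL17

open Finset Leech Golay

/-! ### Data -/

/-- The `30` weight-`8` words of `C₆` (the `12` pairs and `18` squares), as `16`-bit masks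
(cell `(i,j)` ↦ bit `4i+j`). [cite: CohnLi2024, §3 Def. 3.1] -/
def w8 (i : ℕ) : ℕ :=
  match i with
  | 0 => 255 | 1 => 3855 | 2 => 4080 | 3 => 13107 | 4 => 13260 | 5 => 15420 | 6 => 15555 | 7 => 21845
  | 8 => 21930 | 9 => 23130 | 10 => 23205 | 11 => 26214 | 12 => 26265 | 13 => 26985 | 14 => 27030 | 15 => 38505
  | 16 => 38550 | 17 => 39270 | 18 => 39321 | 19 => 42330 | 20 => 42405 | 21 => 43605 | 22 => 43690 | 23 => 49980
  | 24 => 50115 | 25 => 52275 | 26 => 52428 | 27 => 61455 | 28 => 61680 | 29 => 65280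
  | _ => 0

/-- The `16` crosses of `C₆` (weight `6`: a row plus a column without their common cell).
[cite: CohnLi2024, §3 Def. 3.1] -/
def x6 (i : ℕ) : ℕ :=
  match i with
  | 0 => 4382 | 1 => 4577 | 2 => 7697 | 3 => 8749 | 4 => 8914 | 5 => 11554 | 6 => 17483 | 7 => 17588
  | 8 => 19268 | 9 => 30856 | 10 => 34696 | 11 => 34936 | 12 => 34951 | 13 => 46148 | 14 => 53794 | 15 => 57617
  | _ => 0

/-- Generators of `C₅ = RM(1,4)` (the span of the pairs and squares): `r₀+r₁, r₀+r₂, c₀+c₁, c₀+c₂, 𝟙`.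
[cite: CohnLi2024, §3, proof of Lemma 3.3] -/
def c5gen (i : ℕ) : ℕ :=
  match i with
  | 0 => 255 | 1 => 3855 | 2 => 13107 | 3 => 21845 | 4 => 65535
  | _ => 0

/-- Coset representatives of `C₅` in `C₁₀`: cosets `0…5` form `C⁺`, cosets `6…11` form `C⁻`, two disjoint
`192`-word subcodes of `C₁₀` of minimum distance `6`. [cite: CohnLi2024, Lemma 3.3] -/
def rep (i : ℕ) : ℕ :=
  match i with
  | 0 => 0 | 1 => 854 | 2 => 1379 | 3 => 4472 | 4 => 4637 | 5 => 5198
  | 6 => 51 | 7 => 869 | 8 => 1360 | 9 => 4427 | 10 => 4654 | 11 => 5245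
  | _ => 0

/-- `XOR` of the generators of `C₅` selected by the bits of `m`, using the first `j` generators. -/
def c5Aux : ℕ → ℕ → ℕ
  | 0, _ => 0
  | j + 1, m => (if m.testBit j then c5gen j else 0) ^^^ c5Aux j m

/-- The element of `C₅` with coordinates `m < 32`. -/
def c5 (m : ℕ) : ℕ := c5Aux 5 m

/-- The word of `C⁺ ∪ C⁻` with index `(p, m)`: coset `p < 12`, element `m < 32` of `C₅`. -/
def cd (p m : ℕ) : ℕ := rep p ^^^ c5 m

/-- `c5Aux` is additive. -/
theorem c5Aux_xor (j m m' : ℕ) : c5Aux j (m ^^^ m') = c5Aux j m ^^^ c5Aux j m' := by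
  induction j with
  | zero => simp [c5Aux]
  | succ j ih =>
    simp only [c5Aux, Nat.testBit_xor, ih]
    cases m.testBit j <;> cases m'.testBit j <;> simp [Nat.xor_assoc, Nat.xor_left_comm]

/-- `c5` is additive. -/
theorem c5_xor (m m' : ℕ) : c5 (m ^^^ m') = c5 m ^^^ c5 m' := c5Aux_xor 5 m m'

/-- Differences inside `C⁺ ∪ C⁻`. -/
theorem cd_xor (p p' m m' : ℕ) : cd p m ^^^ cd p' m' = rep p ^^^ rep p' ^^^ c5 (m ^^^ m') := by
  unfold cd; rw [c5_xor]
  simp only [Nat.xor_assoc, Nat.xor_left_comm, Nat.xor_comm]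

/-! ### Bit counts: `wt` and intersections as `popK` -/

/-- The weight is the bit count on all `24` coordinates. -/
theorem wt_eq_popK (m : ℕ) : wt m = popK 24 24 m := by
  rw [← wtK_eq_popK]
  unfold wt wtK supp
  congr 1; ext j; simp

/-- Support of an `AND` is the intersection of the supports. -/
theorem supp_land (m n : ℕ) : supp (m &&& n) = supp m ∩ supp n := by
  ext j; simp [supp]

/-- The size of the intersection of two supports is a bit count. -/
theorem card_supp_inter (m n : ℕ) : (supp m ∩ supp n).card = popK 24 24 (m &&& n) := by
  rw [← supp_land, ← wt_eq_popK]; rfl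

/-- A word `< 2¹⁶` is supported on the coordinates `< 16`. -/
theorem val_lt_of_mem_supp {m : ℕ} (hm : m < 65536) {j : Fin 24} (hj : j ∈ supp m) : j.val < 16 := by
  by_contra h
  have h2 : 2 ^ 16 ≤ 2 ^ j.val := Nat.pow_le_pow_right (by norm_num) (by omega)
  have := Nat.testBit_eq_false_of_lt (lt_of_lt_of_le hm h2)
  simp [supp, this] at hj

/-! ### Kernel facts -/

/-- Pairs and squares have weight `8` and live on the `16` matrix cells. [cite: CohnLi2024, §3 Def. 3.1] -/
theorem w8_facts : ∀ i < 30, popK 24 24 (w8 i) = 8 ∧ w8 i < 65536 := by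
  decide +kernel

/-- Crosses have weight `6` and live on the `16` matrix cells. [cite: CohnLi2024, §3 Def. 3.1] -/
theorem x6_facts : ∀ i < 16, popK 24 24 (x6 i) = 6 ∧ x6 i < 65536 := by
  decide +kernel

set_option maxRecDepth 100000 in
/-- Two distinct pairs/squares meet in at most `4` cells (`C₆` has no word of weight `< 6` other than `0`). -/
theorem w8_inter : ∀ i < 30, ∀ i' < 30, i = i' ∨ popK 24 24 (w8 i &&& w8 i') ≤ 4 := by
  decide +kernel

set_option maxRecDepth 100000 in
/-- A pair/square meets a cross in at most `4` cells. -/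
theorem w8_x6_inter : ∀ i < 30, ∀ i' < 16, popK 24 24 (w8 i &&& x6 i') ≤ 4 := by
  decide +kernel

set_option maxRecDepth 100000 in
/-- Two distinct crosses meet in exactly `2` (hence at most `2`) cells. -/
theorem x6_inter : ∀ i < 16, ∀ i' < 16, i = i' ∨ popK 24 24 (x6 i &&& x6 i') ≤ 2 := by
  decide +kernel

set_option maxRecDepth 100000 in
/-- **`C₁₀ ⊥ C₆`**, coset representatives: every `rep p` meets every pair, square and cross in an even number
of cells. [cite: CohnLi2024, §3] -/
theorem rep_orth : ∀ p < 12,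
    (∀ i < 30, popK 24 24 (w8 i &&& rep p) % 2 = 0) ∧ ∀ i < 16, popK 24 24 (x6 i &&& rep p) % 2 = 0 := by
  decide +kernel

set_option maxRecDepth 100000 in
/-- **`C₁₀ ⊥ C₆`**, generators of `C₅`: every `c5gen j` meets every pair, square and cross in an even number of
cells. [cite: CohnLi2024, §3] -/
theorem c5gen_orth : ∀ j < 5,
    (∀ i < 30, popK 24 24 (w8 i &&& c5gen j) % 2 = 0) ∧ ∀ i < 16, popK 24 24 (x6 i &&& c5gen j) % 2 = 0 := by
  decide +kernel

set_option maxRecDepth 100000 in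
set_option maxHeartbeats 2000000 in
/-- **Distances in `C⁺ ∪ C⁻`** (kernel check over the `12 · 12 · 32` coset differences, counted on the cells
`< 16`): two distinct words of the same half are at distance `≥ 6`, two words of different halves at distance
`≥ 4` (the halves are `p / 6 ∈ {0, 1}`). [cite: CohnLi2024, Lemma 3.3] -/
theorem cd_dist : ∀ p < 12, ∀ p' < 12, ∀ m < 32, (p = p' ∧ m = 0) ∨
    6 ≤ popK 16 24 (rep p ^^^ rep p' ^^^ c5 m) ∨ (p / 6 ≠ p' / 6 ∧ 4 ≤ popK 16 24 (rep p ^^^ rep p' ^^^ c5 m)) := by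
  decide +kernel

/-! ### Consequences in `Finset` language -/

/-- `|supp (w8 i)| = 8`. -/
theorem card_supp_w8 (i : Fin 30) : (supp (w8 i)).card = 8 := by
  have h := (w8_facts i i.isLt).1
  rw [← wt_eq_popK] at h; exact h

/-- `|supp (x6 i)| = 6`. -/
theorem card_supp_x6 (i : Fin 16) : (supp (x6 i)).card = 6 := by
  have h := (x6_facts i i.isLt).1
  rw [← wt_eq_popK] at h; exact h

/-- Pairs/squares are supported on the cells `< 16`. -/
theorem supp_w8_lt {i : ℕ} (hi : i < 30) : ∀ j ∈ supp (w8 i), j.val < 16 :=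
  fun _ hj => val_lt_of_mem_supp (w8_facts i hi).2 hj

/-- Crosses are supported on the cells `< 16`. -/
theorem supp_x6_lt {i : ℕ} (hi : i < 16) : ∀ j ∈ supp (x6 i), j.val < 16 :=
  fun _ hj => val_lt_of_mem_supp (x6_facts i hi).2 hj

/-- Distinct pairs/squares meet in `≤ 4` cells. -/
theorem card_w8_inter_w8 {i i' : ℕ} (hi : i < 30) (hi' : i' < 30) (hne : i ≠ i') :
    (supp (w8 i) ∩ supp (w8 i')).card ≤ 4 := by
  rw [card_supp_inter]
  rcases w8_inter i hi i' hi' with h | h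
  · exact absurd h hne
  · exact h

/-- A pair/square and a cross meet in `≤ 4` cells. -/
theorem card_w8_inter_x6 {i i' : ℕ} (hi : i < 30) (hi' : i' < 16) :
    (supp (w8 i) ∩ supp (x6 i')).card ≤ 4 := by
  rw [card_supp_inter]; exact w8_x6_inter i hi i' hi'

/-- Distinct crosses meet in `≤ 2` cells. -/
theorem card_x6_inter_x6 {i i' : ℕ} (hi : i < 16) (hi' : i' < 16) (hne : i ≠ i') :
    (supp (x6 i) ∩ supp (x6 i')).card ≤ 2 := by
  rw [card_supp_inter]
  rcases x6_inter i hi i' hi' with h | h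
  · exact absurd h hne
  · exact h

/-- The pairs/squares table is injective on `range 30`. -/
theorem w8_inj {i i' : ℕ} (hi : i < 30) (hi' : i' < 30) (h : supp (w8 i) = supp (w8 i')) : i = i' := by
  by_contra hne
  have h4 := card_w8_inter_w8 hi hi' hne
  rw [← h, Finset.inter_self, card_supp_w8 ⟨i, hi⟩] at h4
  omega

/-- The crosses table is injective on `range 16`. -/
theorem x6_inj {i i' : ℕ} (hi : i < 16) (hi' : i' < 16) (h : supp (x6 i) = supp (x6 i')) : i = i' := by
  by_contra hne
  have h2 := card_x6_inter_x6 hi hi' hne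
  rw [← h, Finset.inter_self, card_supp_x6 ⟨i, hi⟩] at h2
  omega

/-- Parity of the number of cells of `S` carrying a `1` is additive under `XOR`. -/
theorem even_inter_supp_xor {S : Finset (Fin 24)} {x y : ℕ} (hx : Even (S ∩ supp x).card)
    (hy : Even (S ∩ supp y).card) : Even (S ∩ supp (x ^^^ y)).card := by
  rw [← card_filter_testBit] at hx hy ⊢
  have h := card_filter_xor_add_finset S (fun j => x.testBit j.val) (fun j => y.testBit j.val)
  have e : (S.filter fun j : Fin 24 => (x ^^^ y).testBit j.val = true) =
      S.filter fun j => (x.testBit j.val ^^ y.testBit j.val) = true := by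
    congr 1; ext j; rw [Nat.testBit_xor]
  rw [e]
  obtain ⟨a, ha⟩ := hx; obtain ⟨b, hb⟩ := hy
  exact ⟨a + b - (S.filter fun j => (x.testBit j.val && y.testBit j.val) = true).card, by omega⟩

/-- Parity through the span of `C₅`. -/
theorem even_inter_supp_c5Aux {S : Finset (Fin 24)} (hgen : ∀ j < 5, Even (S ∩ supp (c5gen j)).card) :
    ∀ j ≤ 5, ∀ m, Even (S ∩ supp (c5Aux j m)).card
  | 0, _, m => by simp [c5Aux, supp]
  | j + 1, hj, m => by
    simp only [c5Aux]
    apply even_inter_supp_xor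
    · split_ifs
      · exact hgen j (by omega)
      · simp [supp]
    · exact even_inter_supp_c5Aux hgen j (by omega) m

/-- A word of `C⁺ ∪ C⁻` meets a pair/square evenly. -/
theorem even_card_w8_inter_cd {i p : ℕ} (hi : i < 30) (hp : p < 12) (m : ℕ) :
    Even (supp (w8 i) ∩ supp (cd p m)).card := by
  unfold cd
  apply even_inter_supp_xor
  · rw [card_supp_inter, Nat.even_iff]; exact (rep_orth p hp).1 i hi
  · exact even_inter_supp_c5Aux (fun j hj => by rw [card_supp_inter, Nat.even_iff]; exact (c5gen_orth j hj).1 i hi)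
      5 le_rfl m

/-- A word of `C⁺ ∪ C⁻` meets a cross evenly. -/
theorem even_card_x6_inter_cd {i p : ℕ} (hi : i < 16) (hp : p < 12) (m : ℕ) :
    Even (supp (x6 i) ∩ supp (cd p m)).card := by
  unfold cd
  apply even_inter_supp_xor
  · rw [card_supp_inter, Nat.even_iff]; exact (rep_orth p hp).2 i hi
  · exact even_inter_supp_c5Aux (fun j hj => by rw [card_supp_inter, Nat.even_iff]; exact (c5gen_orth j hj).2 i hi)
      5 le_rfl m

/-- `m ⊕ m' < 32` for `m, m' < 32`. -/
theorem xor_lt_32 {m m' : ℕ} (hm : m < 32) (hm' : m' < 32) : m ^^^ m' < 32 := by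
  have := Nat.xor_lt_two_pow (n := 5) (by simpa using hm) (by simpa using hm'); simpa using this

/-- **Distances, restricted-weight form**: for two distinct indices the difference has `≥ 6` ones on the cells
when the halves agree and `≥ 4` ones in any case. -/
theorem wtK_cd_xor {p p' m m' : ℕ} (hp : p < 12) (hp' : p' < 12) (hm : m < 32) (hm' : m' < 32)
    (hne : ¬ (p = p' ∧ m = m')) :
    (p / 6 = p' / 6 → 6 ≤ wtK 16 (cd p m ^^^ cd p' m')) ∧ 4 ≤ wtK 16 (cd p m ^^^ cd p' m') := by
  rw [cd_xor, wtK_eq_popK]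
  rcases cd_dist p hp p' hp' (m ^^^ m') (xor_lt_32 hm hm') with ⟨rfl, h0⟩ | h6 | ⟨hx, h4⟩
  · exact absurd ⟨rfl, eq_of_xor_eq_zero h0⟩ hne
  · exact ⟨fun _ => h6, le_trans (by norm_num) h6⟩
  · exact ⟨fun h => absurd h hx, h4⟩

end Summit.Ventures.PackingBounds.Config.CL17
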